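import Mathlib
import Summits.Ventures.HodgeRepro2.T6A1ComplexWeil

/-!
# T6A1Glue — the A1 facts consumed by A2 / A3, in the shapes they asked for

Tier-6 sub-goal A1 (route/T6-A1-t6-p1.md §3; TARGET-T6.md §2 Layer II). Three consumer-facing statements
assembled from the A1 files: the rational Weil projector `pW` takes `H⁴(B, ℚ)` into the rational Weil
line `weilQ K` and preserves the algebraic classes `D.Alg 2` of a `TransferShadow` (Prop. A2.3(ii),(iv):
t6-p3's `pW` binders), and a family of eigenvectors `v σ` spanning `K ⊗ ℂ` with `eigenLineK K σ = ℂ·v σ`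
(TIER4 (A0.4), (A0.6): the generators `e_{i,σ}` — t6-p2's generator binders and t6-p3's eigenbasis).
-/

namespace Summit.Ventures.HodgeRepro2.T6.A1Glue

open Polynomial A1WeilProjector A1ProjData A2Model A1Complex A1ComplexWeil

variable (K : Type*) [Field K] [NumberField K]

section projector

variable [IsGalois ℚ K] [DecidableEq (K →+* ℂ)] [DecidableEq (K →ₐ[ℚ] K)] [DecidableEq K]
variable (P : WeilProjData K 4)

omit [DecidableEq (K →+* ℂ)] in
/-- `p_W` takes `H⁴(B, ℚ)` into the rational Weil line (Prop. A2.3(iv): `W_F(B) = p_W(H⁴(B, ℚ))`). -/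
theorem pW_mem_weilQ {a : HB K} (ha : a ∈ degB K 4) : pW K P a ∈ weilQ K := by
  have h : pW K P a ∈ (weilQ K : Set (HB K)) := by
    rw [weilQ_eq_image K P]
    exact ⟨a, ha, rfl⟩
  exact h

omit [DecidableEq (K →+* ℂ)] in
/-- `p_W` is the identity on the rational Weil line. -/
theorem pW_apply_of_mem_weilQ {a : HB K} (ha : a ∈ weilQ K) : pW K P a = a := by
  have ha' : a ∈ (weilQ K : Set (HB K)) := ha
  rw [weilQ_eq_image K P] at ha'
  obtain ⟨b, hb, rfl⟩ := ha'
  change pW K P (pW K P (⟨b, hb⟩ : ⋀[ℚ]^4 (H1 K)) : HB K) = _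
  rw [pW_coe, pW_coe]
  congr 1
  exact P.proj_apply_of_mem_range (H1 K) ⟨_, rfl⟩

omit [IsGalois ℚ K] [DecidableEq (K →+* ℂ)] [DecidableEq (K →ₐ[ℚ] K)] [DecidableEq K] in
/-- `p_W` preserves the algebraic classes (Prop. A2.3(ii): a polynomial in `[x]^*`, `D.alg_pull`). -/
theorem pW_mem_alg {F : FaceSetting K} (D : TransferShadow F) (x : K) (Q : ℚ[X]) {a : HB K}
    (ha : a ∈ D.Alg 2) : aeval (pullEndo K x).toLinearMap Q a ∈ D.Alg 2 :=
  BridgeProjector.aeval_apply_mem_of_stable (D.Alg 2) (fun _ hv => D.alg_pull x hv) Q ha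

omit [IsGalois ℚ K] [DecidableEq (K →+* ℂ)] in
/-- `p_W` preserves the algebraic classes of degree 4 (Prop. A2.3(ii)). -/
theorem pW_mem_alg' {F : FaceSetting K} (D : TransferShadow F) {a : HB K} (ha : a ∈ D.Alg 2) :
    pW K P a ∈ D.Alg 2 :=
  pW_mem_alg K D P.x P.Q ha

omit [DecidableEq (K →+* ℂ)] [DecidableEq (K →ₐ[ℚ] K)] [DecidableEq K] in
/-- LINE-HIT in the pointwise form (Theorem A1(iv)): one non-zero algebraic element of the rational Weil
line makes every element of it algebraic. -/
theorem lineHit {F : FaceSetting K} (D : TransferShadow F) {w : HB K} (hw : w ∈ weilQ K) (hw0 : w ≠ 0)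
    (hA : w ∈ D.Alg 2) : WeilClassesAlgebraic D :=
  A1Main.A1_lineHit D ⟨w, hw, hw0, hA⟩

omit [DecidableEq (K →+* ℂ)] in
/-- LINE-HIT through the projector: if `p_W y ≠ 0` for some algebraic class `y` of degree 4, every
split Weil class is algebraic (TIER4 Theorem A's closing step, Prop. A3.2 applied to `p_W(y)`). -/
theorem lineHit_of_pW_ne_zero {F : FaceSetting K} (D : TransferShadow F) {y : HB K}
    (hy : y ∈ D.Alg 2) (hne : pW K P y ≠ 0) : WeilClassesAlgebraic D :=
  lineHit K D (pW_mem_weilQ K P (D.alg_deg 2 hy)) hne (pW_mem_alg' K P D hy)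

end projector

/-- TIER4 (A0.4) as an eigenbasis: a family `v σ ∈ K ⊗ ℂ` of non-zero eigenvectors, one per embedding,
spanning `K ⊗ ℂ` (`K ⊗ ℂ = ⊕_σ ℂ·v σ`; the generators `e_{i,σ} = single i (v σ)` of (A0.6)). -/
theorem exists_eigenvectors :
    ∃ v : (K →+* ℂ) → KC K, (∀ σ, v σ ≠ 0) ∧ (∀ σ, eigenLineK K σ = Submodule.span ℂ {v σ}) ∧
      Submodule.span ℂ (Set.range v) = ⊤ := by
  choose v hv0 hv using exists_eigenLineK_eq_span K
  refine ⟨v, hv0, hv, ?_⟩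
  rw [← iSup_eigenLineK_eq_top K]
  rw [Submodule.span_range_eq_iSup]
  exact iSup_congr fun σ => (hv σ).symm

end Summit.Ventures.HodgeRepro2.T6.A1Glue
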